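import Summits.Langlands.Langlands.Theorems.IrreducibilityBySelfDualityRegularTwistCMTwistRealisation
import Summits.Langlands.Langlands.Theorems.RegularTwistCM.Negative.AdjointShapeCertificates
import Literature.NumberTheory.Automorphic.StrongMultiplicityOneRepData
import Literature.NumberTheory.Automorphic.GelbartJacquetAdjointLiftArchimedean
import HarnessLib

/-!
# `RegularTwistFromHalfIntegral` (route `IrreducibilityBySelfDuality`, item stmt-Langlands-14726) — helper file:
# the adjoint archimedean shadow modulo Gelbart–Jacquet at infinity, and two bookkeeping lemmas

Helpers for the glue item `HalfIntegralTwistCM → RegularTwistCM` (composition in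
`IrreducibilityBySelfDualityRegularTwistFromHalfIntegral.lean`):

* `adjointArchShadowNonDihedral_of_GJ` — the r3 skeleton's stub 1a
  (`Cruxes/RegularTwistCM/Lines/petersson-hermitian-purity.lean`, `stub_adjointArchShadowNonDihedral`, verbatim
  signature: for cuspidal `π` (GL₃), non-dihedral `σ₀` (GL₂), `ν` (GL₁) with `t_π = d · Ad(t_{σ₀})` a.e., at an
  embedding where `σ₀` has parameter `{x, y}` and `ν` has `{q}`, `π` has `{x - y + q, q, y - x + q}`) PROVED MODULO
  three named facts of the tree: Gelbart–Jacquet 1978 Thm (9.3) with its archimedean clause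
  (`GelbartJacquet_adjoint_lift_archimedean`) and the two `L²` leaves to which the tree reduces strong multiplicity
  one with archimedean components (`CuspidalAutomorphicRepData.hasArchParameter_eq_of_isNearlyEquivalent`):
  the Borel–Jacquet dictionary `hasSatakeParamAt_iff_L2` and `strong_multiplicity_one_gl_sphericalLevel 3 K`
  (Jacquet–Shalika 1981 II, Thm. 4.4);
* `parity_of_purity3` — the parity of `(s₁ - s₂)(ι) + (s₁ - s₂)(ῑ)` from Clozel purity of the adjoint shape;
* `exists_paired_exponents_of_hasInfinityType` — paired exponent functions of a well-formed rank-2 infinity type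
  (the skeleton's lemma, lead prover-line-stmt-Langlands-14069-0).
-/

set_option linter.dupNamespace false

noncomputable section

open scoped ComplexConjugate Classical
open NumberField Filter
open Literature.NumberTheory.Automorphic

namespace Summit.Langlands.Langlands.Theorems

namespace RegularTwistFromHalfIntegral

/-! ## The adjoint archimedean shadow, modulo Gelbart–Jacquet at infinity and strong multiplicity one -/

/-- **The adjoint archimedean shadow for non-dihedral `σ₀`** (the skeleton's stub 1a, verbatim),
PROVED MODULO the named facts `GelbartJacquet_adjoint_lift_archimedean` (Gelbart–Jacquet 1978,
Thm. (9.3) with Prop. (3.2): the cuspidal lift `P` of a non-dihedral `σ₀` has `t_P = Ad(t_{σ₀})` a.e. and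
Harish-Chandra parameter `{a - b, b - a, 0}` at an embedding where `σ₀` has `{a, b}`),
`hasSatakeParamAt_iff_L2` (Borel–Jacquet 1979, 4.6) and `strong_multiplicity_one_gl_sphericalLevel 3`
(Jacquet–Shalika 1981 II, Thm. 4.4). Proof: twist `P` by `ν` (`stub_twistRealisation`, proved): the
twist `P'` has parameter `{a - b + q, b - a + q, q}` and `t_{P'} = d · Ad(t_{σ₀}) = t_π` a.e. (Satake
uniqueness for `ν`, Flath), so `π` and `P'` are nearly equivalent cuspidal data on `GL₃`, hence have the
same archimedean parameter (`hasArchParameter_eq_of_isNearlyEquivalent`).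
[cite: GelbartJacquet1978, Thm. (9.3), Prop. (3.2)] [cite: JacquetShalikaAJM1981II, Thm. 4.4] -/
theorem adjointArchShadowNonDihedral_of_GJ
    (hGJ : GelbartJacquet_adjoint_lift_archimedean)
    (hL2 : ∀ (K : Type) [Field K] [NumberField K] (hcpt : isCompact_glFiniteIntegralLevel 3 K)
      (μ : MeasureTheory.Measure (AdelicGroupData.gl 3 K).automorphicQuotient)
      [(AdelicGroupData.gl 3 K).IsAutomorphicMeasure μ], hasSatakeParamAt_iff_L2 hcpt μ)
    (hsmo : ∀ (K : Type) [Field K] [NumberField K], strong_multiplicity_one_gl_sphericalLevel 3 K) :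
    ∀ (K : Type) [Field K] [NumberField K]
      (h1 : isCompact_glFiniteIntegralLevel 1 K) (hcpt₂ : isCompact_glFiniteIntegralLevel 2 K)
      (hcpt : isCompact_glFiniteIntegralLevel 3 K)
      (π : CuspidalAutomorphicRepData 3 K hcpt) (σ₀ : CuspidalAutomorphicRepData 2 K hcpt₂)
      (ν : CuspidalAutomorphicRepData 1 K h1),
      (∀ (L : Type) [Field L] [NumberField L] [Algebra K L], Module.finrank K L = 2 →
        ¬ IsQuadraticSelfTwistAE L σ₀.1) →
      (∀ᶠ v in cofinite, ∀ α β : Multiset ℂ, π.1.HasSatakeParamAt v α →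
        σ₀.1.HasSatakeParamAt v β → ∃ d : ℂ, ν.1.HasSatakeParamAt v {d} ∧
          α = (((β ×ˢ β).map (fun r : ℂ × ℂ => r.1 * r.2⁻¹)).erase 1).map (fun e => d * e)) →
      ∀ (χπ χσ χν : (K →+* ℂ) → Multiset ℂ),
        π.1.HasArchParameter χπ → σ₀.1.HasArchParameter χσ → ν.1.HasArchParameter χν →
        ∀ (ι : K →+* ℂ) (x y q : ℂ), χσ ι = {x, y} → χν ι = {q} →
          χπ ι = {x - y + q, q, y - x + q} := by
  intro K _ _ h1 hcpt₂ hcpt π σ₀ ν hnd hAd χπ χσ χν hπ hσ hν ι x y q hxy hq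
  classical
  haveI : NeZero (3 : ℕ) := ⟨by norm_num⟩
  -- the parameter of `ν` is a family of singletons `{p σ}`
  have h1c : ∀ σ : K →+* ℂ, ∃ a : ℂ, χν σ = {a} := fun σ =>
    Multiset.card_eq_one.mp (AutomorphicRepData.card_eq_of_hasArchParameter hν σ)
  choose p hp using h1c
  have hνp : ν.1.HasArchParameter (fun σ => {p σ}) := by
    have e : χν = fun σ => {p σ} := funext hp
    rw [← e]
    exact hν
  -- the Gelbart–Jacquet lift `P` of `σ₀` with its archimedean clause (named fact)
  obtain ⟨P, hPsat, hParch⟩ := hGJ K hcpt₂ hcpt σ₀ hnd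
  have hPχ : P.1.HasArchParameter (fun σ => (((χσ σ) ×ˢ (χσ σ)).map fun r => r.1 - r.2).erase 0) :=
    hParch χσ hσ
  -- the twist `P' = P ⊗ ν` (proved stub 5)
  obtain ⟨P', hP'arch, hP'sat⟩ :=
    RegularTwistCM.stub_twistRealisation 3 K h1 hcpt P ν _ p hPχ hνp
  -- `π` and `P'` are nearly equivalent
  have hne : π.1.IsNearlyEquivalent P'.1 := by
    have hcπ : ∀ᶠ v in cofinite, π.1.IsUnramifiedAt v :=
      AutomorphicRepData.hasSatakeParamAt_cofinite_holds π.1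
    have hcσ : ∀ᶠ v in cofinite, σ₀.1.IsUnramifiedAt v :=
      AutomorphicRepData.hasSatakeParamAt_cofinite_holds σ₀.1
    filter_upwards [hAd, hPsat, hP'sat, hcπ, hcσ] with v hv hPv hP'v hπv hσv
    obtain ⟨α, hα⟩ := hπv
    obtain ⟨β, hβ⟩ := hσv
    obtain ⟨d, hd, hαeq⟩ := hv α β hα hβ
    obtain ⟨c, hc, hP'c⟩ := hP'v (adParams β) (hPv β hβ)
    have hcd : c = d :=
      Multiset.singleton_inj.mp (AutomorphicRepData.hasSatakeParamAt_unique_holds ν.1 hc hd)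
    have had : adParams β = ((β ×ˢ β).map (fun r : ℂ × ℂ => r.1 * r.2⁻¹)).erase 1 := rfl
    refine ⟨α, hα, ?_⟩
    rw [hαeq, ← had, ← hcd]
    exact hP'c
  -- strong multiplicity one with the archimedean components (tree, modulo the two named facts)
  obtain ⟨μm, hμm⟩ := AdelicGroupData.exists_isAutomorphicMeasure_gl_holds 3 K
  haveI := hμm
  have heq := CuspidalAutomorphicRepData.hasArchParameter_eq_of_isNearlyEquivalent
    (hL2 K hcpt μm) (hsmo K) π P' hne hπ hP'arch
  -- read off at `ι`
  have hpq : p ι = q := by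
    have h := hp ι
    rw [hq] at h
    exact (Multiset.singleton_inj.mp h).symm
  have hι : χπ ι = ((((χσ ι) ×ˢ (χσ ι)).map fun r => r.1 - r.2).erase 0).map (· + p ι) :=
    congr_fun heq ι
  rw [hι, hxy, hpq]
  exact (RegularTwistCM.Negative.adjointShape_eq x y q).symm

/-! ## Bookkeeping lemmas -/

/-- **Parity from purity of an adjoint parameter** (three-term arithmetic progressions; the
arithmetic of the skeleton's `parity_of_mirror3` with Clozel's `a ↦ w - a` in place of `a ↦ -ā + c`).
If `{s₁' - s₂' + q', q', s₂' - s₁' + q'}` is the image of `{s₁ - s₂ + q, q, s₂ - s₁ + q}` under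
`z ↦ w - z` with `s₁ - s₂ ∈ ℤ` and `s₁' - s₂' ≠ 0`, then comparing means gives `q' = w - q`, and
`s₁' - s₂' ∈ {-(s₁ - s₂), 0, s₁ - s₂}` with `0` excluded, so `(s₁ - s₂) + (s₁' - s₂') ∈ {0, 2(s₁ - s₂)}`.
[folklore] -/
theorem parity_of_purity3 {s₁ s₂ q s₁' s₂' q' : ℂ} {w : ℤ} (hZa : ∃ k : ℤ, s₁ - s₂ = k)
    (ha' : s₁' - s₂' ≠ 0)
    (h : ({s₁' - s₂' + q', q', s₂' - s₁' + q'} : Multiset ℂ) =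
      (({s₁ - s₂ + q, q, s₂ - s₁ + q} : Multiset ℂ)).map (fun z => (w : ℂ) - z)) :
    ∃ m : ℤ, (s₁ - s₂) + (s₁' - s₂') = 2 * m := by
  obtain ⟨k, hk⟩ := hZa
  have hk' : s₂ - s₁ = -(k : ℂ) := by linear_combination -hk
  rw [hk, hk'] at h
  simp only [Multiset.insert_eq_cons, Multiset.map_cons, Multiset.map_singleton] at h
  -- the means agree: `3 q' = 3 (w - q)`
  have hsum := congrArg Multiset.sum h
  simp only [Multiset.sum_cons, Multiset.sum_singleton] at hsum
  have hq' : q' = (w : ℂ) - q := by linear_combination hsum / 3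
  -- `s₁' - s₂' + q'` is one of the three entries
  have hmem : s₁' - s₂' + q' ∈ (((w : ℂ) - ((k : ℂ) + q)) ::ₘ ((w : ℂ) - q) ::ₘ
      ({(w : ℂ) - (-(k : ℂ) + q)} : Multiset ℂ)) := by
    rw [← h]
    exact Multiset.mem_cons_self _ _
  simp only [Multiset.mem_cons, Multiset.mem_singleton] at hmem
  rcases hmem with h1 | h1 | h1
  · exact ⟨0, by push_cast; linear_combination hk + h1 - hq'⟩
  · exact absurd (by linear_combination h1 - hq') ha'
  · exact ⟨k, by linear_combination hk + h1 - hq'⟩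

/-- **Paired exponent functions from a well-formed rank-2 infinity type** (the skeleton's lemma,
lead prover-line-stmt-Langlands-14069-0). If `σ₀` (any datum on `GL₂`) has infinity type `T`, there are
functions `s₁ s₂` on the complex embeddings with `{s₁ ι, s₂ ι}` the archimedean parameter at `ι` and
`s_i ι - s_i ῑ ∈ ℤ` (choose, above each place `w`, an enumeration `{ω₁, ω₂}` of `T σ_w` and put
`s_i σ_w = a(ω_i)`, `s_i σ̄_w = b(ω_i)`; at a real place `σ̄_w = σ_w`). [folklore] -/
theorem exists_paired_exponents_of_hasInfinityType {K : Type} [Field K] [NumberField K]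
    {hcpt₂ : isCompact_glFiniteIntegralLevel 2 K} {σ₀ : AutomorphicRepData (AutomorphyDatum.gl 2 K hcpt₂)}
    {T : InfinityType K 2} (hT : σ₀.HasInfinityType T) :
    ∃ s₁ s₂ : (K →+* ℂ) → ℂ, σ₀.HasArchParameter (fun ι => {s₁ ι, s₂ ι}) ∧
      ∀ ι : K →+* ℂ, (∃ m : ℤ, s₁ ι - s₁ (ComplexEmbedding.conjugate ι) = m) ∧
        (∃ m : ℤ, s₂ ι - s₂ (ComplexEmbedding.conjugate ι) = m) := by
  classical
  obtain ⟨⟨hcard, hswap⟩, harch⟩ := hT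
  -- an enumeration of `T` above each place, read at the distinguished embedding `σ_w`
  have hex : ∀ w : InfinitePlace K, ∃ xy : ArchWeight × ArchWeight, T w.embedding = {xy.1, xy.2} := by
    intro w
    obtain ⟨x, y, hxy⟩ := Multiset.card_eq_two.mp (hcard w.embedding)
    exact ⟨(x, y), hxy⟩
  choose e he using hex
  -- the exponent functions
  let s₁ : (K →+* ℂ) → ℂ := fun ι =>
    if ι = (InfinitePlace.mk ι).embedding then (e (InfinitePlace.mk ι)).1.a else (e (InfinitePlace.mk ι)).1.b
  let s₂ : (K →+* ℂ) → ℂ := fun ι =>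
    if ι = (InfinitePlace.mk ι).embedding then (e (InfinitePlace.mk ι)).2.a else (e (InfinitePlace.mk ι)).2.b
  -- every embedding is `σ_w` or `σ̄_w`, `w = mk ι`
  have hdich : ∀ ι : K →+* ℂ, ι = (InfinitePlace.mk ι).embedding ∨
      (ι ≠ (InfinitePlace.mk ι).embedding ∧ ι = ComplexEmbedding.conjugate (InfinitePlace.mk ι).embedding) := by
    intro ι
    by_cases h : ι = (InfinitePlace.mk ι).embedding
    · exact Or.inl h
    · right
      refine ⟨h, ?_⟩
      rcases InfinitePlace.mk_eq_iff.mp (InfinitePlace.mk_embedding (InfinitePlace.mk ι)) with h1 | h1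
      · exact absurd h1.symm h
      · exact h1.symm
  -- the parameter multisets agree
  have hmul : ∀ ι : K →+* ℂ, ({s₁ ι, s₂ ι} : Multiset ℂ) = (T ι).map ArchWeight.a := by
    intro ι
    rcases hdich ι with h | ⟨hne, h⟩
    · have e1 : s₁ ι = (e (InfinitePlace.mk ι)).1.a := if_pos h
      have e2 : s₂ ι = (e (InfinitePlace.mk ι)).2.a := if_pos h
      rw [e1, e2]
      conv_rhs => rw [h, he (InfinitePlace.mk ι)]
      simp
    · have e1 : s₁ ι = (e (InfinitePlace.mk ι)).1.b := if_neg hne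
      have e2 : s₂ ι = (e (InfinitePlace.mk ι)).2.b := if_neg hne
      rw [e1, e2]
      conv_rhs => rw [h, hswap, he (InfinitePlace.mk ι)]
      simp
  refine ⟨s₁, s₂, ?_, fun ι => ?_⟩
  · have hfun : (fun ι : K →+* ℂ => ({s₁ ι, s₂ ι} : Multiset ℂ)) = fun ι => (T ι).map ArchWeight.a :=
      funext hmul
    rw [hfun]
    exact harch
  · -- the pairing
    have hmk : InfinitePlace.mk (ComplexEmbedding.conjugate ι) = InfinitePlace.mk ι :=
      InfinitePlace.mk_conjugate_eq ι
    rcases hdich ι with h | ⟨hne, h⟩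
    · by_cases hr : ComplexEmbedding.conjugate ι = ι
      · -- real place
        refine ⟨⟨0, ?_⟩, ⟨0, ?_⟩⟩ <;> simp [hr]
      · -- complex place, `ι = σ_w`: `ῑ` takes the `b`-branch
        have hne' : ComplexEmbedding.conjugate ι ≠ (InfinitePlace.mk (ComplexEmbedding.conjugate ι)).embedding := by
          rw [hmk, ← h]
          exact hr
        have e1 : s₁ ι = (e (InfinitePlace.mk ι)).1.a := if_pos h
        have e2 : s₂ ι = (e (InfinitePlace.mk ι)).2.a := if_pos h
        have f1 : s₁ (ComplexEmbedding.conjugate ι) = (e (InfinitePlace.mk ι)).1.b := by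
          show (if _ then _ else _) = _
          rw [if_neg hne', hmk]
        have f2 : s₂ (ComplexEmbedding.conjugate ι) = (e (InfinitePlace.mk ι)).2.b := by
          show (if _ then _ else _) = _
          rw [if_neg hne', hmk]
        rw [e1, e2, f1, f2]
        exact ⟨(e (InfinitePlace.mk ι)).1.exists_int_sub, (e (InfinitePlace.mk ι)).2.exists_int_sub⟩
    · -- complex place, `ι = σ̄_w`: `ῑ = σ_w` takes the `a`-branch
      have hci : ComplexEmbedding.conjugate ι = (InfinitePlace.mk ι).embedding :=
        (congrArg ComplexEmbedding.conjugate h).trans (star_star _)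
      have hpos : ComplexEmbedding.conjugate ι = (InfinitePlace.mk (ComplexEmbedding.conjugate ι)).embedding := by
        rw [hmk]
        exact hci
      have e1 : s₁ ι = (e (InfinitePlace.mk ι)).1.b := if_neg hne
      have e2 : s₂ ι = (e (InfinitePlace.mk ι)).2.b := if_neg hne
      have f1 : s₁ (ComplexEmbedding.conjugate ι) = (e (InfinitePlace.mk ι)).1.a := by
        show (if _ then _ else _) = _
        rw [if_pos hpos, hmk]
      have f2 : s₂ (ComplexEmbedding.conjugate ι) = (e (InfinitePlace.mk ι)).2.a := by
        show (if _ then _ else _) = _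
        rw [if_pos hpos, hmk]
      rw [e1, e2, f1, f2]
      obtain ⟨m₁, hm₁⟩ := (e (InfinitePlace.mk ι)).1.exists_int_sub
      obtain ⟨m₂, hm₂⟩ := (e (InfinitePlace.mk ι)).2.exists_int_sub
      exact ⟨⟨-m₁, by push_cast; linear_combination -hm₁⟩, ⟨-m₂, by push_cast; linear_combination -hm₂⟩⟩

end RegularTwistFromHalfIntegral

end Summit.Langlands.Langlands.Theorems

end
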